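import Summits.BirchSwinnertonDyer.BirchSwinnertonDyer.Theorems.Rank2Observatory2DescClSubCurveCertE2VDefs
import Summits.BirchSwinnertonDyer.BirchSwinnertonDyer.Theorems.ShaPrimaryTransferFiniteShaComponentTransferSelmerCubicE2KRow
import Summits.BirchSwinnertonDyer.BirchSwinnertonDyer.Theorems.ShaPrimaryTransferFiniteShaComponentTransferSelmerCubicCoverNoSub
import HarnessLib

/-!
# BirchSwinnertonDyer — SEL2CUBIC door for the `checkE2KSV` census rows (two-view kills + SUBGROUP SIEVE)

HONEST FRAMING: route `ShaPrimaryTransfer`, seat `bsd-line-spt-p1` (g30), `--supports` item T =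
`FiniteShaComponentTransfer` (stmt-22356), UNCHANGED (conjecture-grade at corank ≥ 2). BSD in rank ≥ 2 is
NOT proved by any of this. THEOREMS ONLY.

The subgroup-sieve kill rows of the rank-2 observatory (`Rank2Observatory2DescClSubCurveCertE2V`,
`rank_le_of_checkE2KSV`) made Selmer-sound: the sieve is sound on Selmer classes exactly as in
`sha_door_of_checkE2KV` (`…SelmerCubicE2KRow`: the kills by `admKillsV_sound_sel` from RESIDUE certificates),
and the closing is the Selmer subgroup count `natCard_selmerGroup_lt_of_coverSet_cl_noSub`
(`…SelmerCubicCoverNoSub`): `Φ(Sel⁽²⁾(E/ℚ))` is a multiplicatively closed subset of the cover set, bounded by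
the kernel search `noSubB`.

* **`sha_door_of_checkE2KSV`** — `checkE2KSV F cc r ks sv` ∧ (every listed kill has a residue certificate) ∧
  `r ≤ rank` ⟹ `t₂(E) = 0 ∧ Ш(E/ℚ)[2^∞] = 0 ∧ rank E(ℚ) = r` for the model `(0, A, 0, B, C)`; the
  decoding of the records is the proof of `rank_le_of_checkE2KSV` verbatim;
* the `K`-free row shapes (`rank_eq_of_certsE2KSV{,_scaled,_complSq,_plain}`) are in `…SelmerCubicE2KSVRows`.
[cite: Cassels1991LecturesEllipticCurves, §15] [cite: SilvermanAEC2009, Thm. X.4.2, Rem. X.4.1]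
[cite: CremonaAlgorithms1997, §3.6]
-/

-- single-conjunct summit: `Summit.BirchSwinnertonDyer.BirchSwinnertonDyer.…` repeats the name by design
set_option linter.dupNamespace false

noncomputable section

open scoped Classical NumberField nonZeroDivisors

open Literature.NumberTheory.NumberFields Literature.NumberTheory.EllipticCurves
  Literature.NumberTheory.GaloisRepresentations Polynomial Module NumberField IsDedekindDomain Ideal
open WeierstrassCurve WeierstrassCurve.Affine

namespace Summit.BirchSwinnertonDyer.BirchSwinnertonDyer.Theorems.ShaPrimaryTransferSelmerCubicCover

open Summit.BirchSwinnertonDyer.BirchSwinnertonDyer.Rank2Observatory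
open Summit.BirchSwinnertonDyer.BirchSwinnertonDyer.Rank2Observatory.TwoDescCubic
open Summit.BirchSwinnertonDyer.BirchSwinnertonDyer.Rank2Observatory.TwoDescCl
open Summit.BirchSwinnertonDyer.BirchSwinnertonDyer.Rank2Observatory.TwoDescCl.ClFieldCert
open Summit.BirchSwinnertonDyer.BirchSwinnertonDyer.Rank2Observatory.TwoDescKill
open Summit.BirchSwinnertonDyer.BirchSwinnertonDyer.Theorems.ShaPrimaryTransferSelmerCubicKill

/-! ## The row door -/

section Row

variable {K : Type} [Field K] [NumberField K] {θ : K}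

/-- **The SEL2CUBIC door for a `checkE2KSV r ks sv` row: `t₂(E) = 0`, `Ш(E/ℚ)[2^∞] = 0`, `rank E(ℚ) = r`.**
For the complex TWO-VIEW certificate with a kill list and the SUBGROUP SIEVE in validity form (`checkE2KSV r ks sv`),
the residue certificate of every listed kill, a curve record passing the checker (model `E = (0, A, 0, B, C)`) and
a lower bound `r ≤ rank E(ℚ)`: the sieve `admE2K` accepts the Cassels class of every `2`-Selmer class
(`admStd_sound_sel`, `valRow_sound_sel`, `admKillsV_sound_sel`), the family is independent modulo squares, so
`#Sel⁽²⁾(E/ℚ) < 2^{r+1}` by the subgroup sieve (`natCard_selmerGroup_lt_of_coverSet_cl_noSub`) and the strict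
descent count closes. UNCONDITIONAL; BSD is not claimed. [cite: Cassels1991LecturesEllipticCurves, §15]
[cite: SilvermanAEC2009, Thm. X.4.2, Rem. X.4.1] [cite: CremonaAlgorithms1997, §3.6] -/
theorem sha_door_of_checkE2KSV (r : ℕ) (F : ClFieldCertE2)
    (hθ : aeval θ (MonicCubic.poly F.fe.base.a F.fe.base.b F.fe.base.c) = 0) (h3 : finrank ℚ K = 3)
    (h2 : F.check2 = true) (hpr : F.fe.primeListE.Forall Nat.Prime) (cc : ClCurveCertE2) (ks : List ClKillE2)
    (sv : List (List ℕ)) (hc : checkE2KSV F cc r ks sv = true)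
    (hk : ∀ k ∈ ks, k.p.Prime ∧ ∃ N : ℕ, ∀ v : ℤ × ℤ × ℤ × ℤ,
      ¬ ((k.p : ℤ) ∣ v.1 ∧ (k.p : ℤ) ∣ v.2.1 ∧ (k.p : ℤ) ∣ v.2.2.1 ∧ (k.p : ℤ) ∣ v.2.2.2) →
      (k.p : ℤ) ^ N ∣ (killQ F.fe.base.a F.fe.base.b F.fe.base.c (k.z F cc) cc.Xt.2.1 cc.Xt.2.2 v).1 →
      (k.p : ℤ) ^ N ∣ (killQ F.fe.base.a F.fe.base.b F.fe.base.c (k.z F cc) cc.Xt.2.1 cc.Xt.2.2 v).2 → False)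
    (hlow : r ≤ ((⟨0, cc.A, 0, cc.B, cc.C⟩ : WeierstrassCurve ℚ)).mordellWeilRank) :
    ((⟨0, cc.A, 0, cc.B, cc.C⟩ : WeierstrassCurve ℚ)).shaCorank 2 = 0 ∧
      AddCommGroup.primaryComponent ((⟨0, cc.A, 0, cc.B, cc.C⟩ : WeierstrassCurve ℚ)).sha 2 = ⊥ ∧
        ((⟨0, cc.A, 0, cc.B, cc.C⟩ : WeierstrassCurve ℚ)).mordellWeilRank = r := by
  classical
  have hK := F.const_of_check2 h2
  have hEE := F.checkE_of_check2 h2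
  have hE := F.fe.checkCoreE_of_checkE hEE
  have hfd := F.fe.checkField_of_checkE hEE
  have hR := F.fe.checkReg_of_coreE hE
  have hprb := F.fe.base_primeList hpr
  have hirr := F.fe.base.irreducible_of_reg hR
  have h0 := (F.fe.base.interval_of_field hfd).1
  have hq := F.fe.base.q_prime hprb
  simp only [checkE2KSV, Bool.and_eq_true, decide_eq_true_eq, List.all_eq_true] at hc
  obtain ⟨⟨⟨⟨⟨⟨⟨⟨⟨⟨⟨⟨⟨⟨⟨⟨⟨⟨⟨hΔ, hirrF⟩, hcub⟩, hder⟩, htvX⟩, htvD⟩, hdisc⟩, hND0⟩, hdn⟩, hdnC⟩, hcodes⟩, hdW1⟩,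
    hdW2⟩, hQ⟩, hhead⟩, hfamAll⟩, hcert⟩, hlite⟩, hSall⟩, hns⟩ := hc
  haveI hEl := isElliptic_of_deltaShort_ne hΔ
  have hirrF' := irreducible_of_noRootMod hirrF
  have hm₁K : (F.m₁ : K) ≠ 0 := m₁_ne_zero_K hK
  have hm₁O : (F.m₁ : 𝓞 K) ≠ 0 := m₁_ne_zero_O hK
  -- `θ_E = e₀`, root of `F`
  have hXe := m₁_mul_eltOf_coe hθ hE hK htvX
  have haevX := aeval_lin_eq_zero_of_coords hθ cc.Xt hcub
  have haev : aeval (algebraMap (𝓞 K) K (eltOf F hθ hE cc.Xt cc.Yt)) (MonicCubic.poly cc.A cc.B cc.C) = 0 := by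
    rw [← hXe] at haevX
    simp only [MonicCubic.poly, map_add, map_mul, map_pow, aeval_X, eq_intCast, map_intCast, map_natCast]
      at haevX ⊢
    have h3' : (F.m₁ : K) ^ 3 ≠ 0 := pow_ne_zero 3 hm₁K
    apply mul_right_injective₀ h3'
    simp only [mul_zero]
    linear_combination haevX
  -- `D₀ = F′(e₀)`
  have hderX := deriv_eq_of_coords hθ cc.Xt (smulCoords (F.m₁ : ℤ) cc.XD) [] hder
  have hderiv : (3 : 𝓞 K) * (eltOf F hθ hE cc.Xt cc.Yt) ^ 2 +
      2 * ((cc.A : ℤ) : 𝓞 K) * (eltOf F hθ hE cc.Xt cc.Yt) + ((cc.B : ℤ) : 𝓞 K) = eltOf F hθ hE cc.XD cc.YD := by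
    rw [lin_smulCoords, ← m₁_mul_eltOf hθ hE hK htvX, ← m₁_mul_eltOf hθ hE hK htvD] at hderX
    simp only [List.map_nil, List.prod_nil, mul_one, Int.cast_mul, Int.cast_pow, Int.cast_natCast] at hderX
    have h2' : (F.m₁ : 𝓞 K) ^ 2 ≠ 0 := pow_ne_zero 2 hm₁O
    apply mul_right_injective₀ h2'
    simp only
    linear_combination hderX
  have hD0 : eltOf F hθ hE cc.XD cc.YD ≠ 0 := eltOf_ne_zero hθ h3 hE hK htvD hND0
  have hq0 : ((F.fe.base.q : ℕ) : 𝓞 K) ≠ 0 := by exact_mod_cast hq.ne_zero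
  have hM0 : eltOf F hθ hE cc.XD cc.YD * ((F.fe.base.q : ℕ) : 𝓞 K) ≠ 0 := mul_ne_zero hD0 hq0
  have hgen := closure_tsupp_eq_top_of_dvd
    (dvd_mul_left ((F.fe.base.q : ℕ) : 𝓞 K) (eltOf F hθ hE cc.XD cc.YD)) (F.fe.closure_q_eq_top_of_coreE hθ h3 hE hpr)
  have hDM : ∀ v : HeightOneSpectrum (𝓞 K), (3 : 𝓞 K) * (eltOf F hθ hE cc.Xt cc.Yt) ^ 2 +
      2 * ((cc.A : ℤ) : 𝓞 K) * (eltOf F hθ hE cc.Xt cc.Yt) + ((cc.B : ℤ) : 𝓞 K) ∈ v.asIdeal →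
      eltOf F hθ hE cc.XD cc.YD * ((F.fe.base.q : ℕ) : 𝓞 K) ∈ v.asIdeal := by
    intro v hv
    rw [hderiv] at hv
    exact Ideal.mul_mem_right _ _ hv
  -- `D₀ ∉ W₁, W₂` (read on `X_D`)
  have hXD_W₁ : lin hθ cc.XD.1 cc.XD.2.1 cc.XD.2.2 ∉ (F.fe.base.W₁r hθ h3 hR hprb).asIdeal :=
    lin_not_mem_of_invCert hθ _ (W₁r_asIdeal hθ h3 hR hprb) hdW1
  have hXD_W₂ : lin hθ cc.XD.1 cc.XD.2.1 cc.XD.2.2 ∉ (F.fe.base.W₂r hθ h3 hR hprb).asIdeal :=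
    lin_not_mem_of_invCert hθ _ (W₂r_asIdeal hθ h3 hR hprb) hdW2
  have hDW₁ : eltOf F hθ hE cc.XD cc.YD ∉ (F.fe.base.W₁r hθ h3 hR hprb).asIdeal := fun h =>
    hXD_W₁ (by rw [← m₁_mul_eltOf hθ hE hK htvD]; exact Ideal.mul_mem_left _ _ h)
  have hDW₂ : eltOf F hθ hE cc.XD cc.YD ∉ (F.fe.base.W₂r hθ h3 hR hprb).asIdeal := fun h =>
    hXD_W₂ (by rw [← m₁_mul_eltOf hθ hE hK htvD]; exact Ideal.mul_mem_left _ _ h)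
  -- the support `T = {W₁, W₂} ∪ code primes`
  set L := cc.codes.length with hL
  let Tf : Fin (L + 2) → HeightOneSpectrum (𝓞 K) := Matrix.vecCons (F.fe.base.W₁r hθ h3 hR hprb)
    (Matrix.vecCons (F.fe.base.W₂r hθ h3 hR hprb) fun i => codePrime2 F hθ h3 hE hpr (cc.codes.get i))
  have hT : ∀ w : HeightOneSpectrum (𝓞 K),
      eltOf F hθ hE cc.XD cc.YD * ((F.fe.base.q : ℕ) : 𝓞 K) ∈ w.asIdeal → ∃ i, Tf i = w := by
    intro w hw
    have hqw : ((F.fe.base.q : ℕ) : 𝓞 K) ∈ w.asIdeal → ∃ i, Tf i = w := fun hqw => by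
      rcases eq_W₁r_or_W₂r hθ h3 hR hprb w hqw with rfl | rfl
      · exact ⟨0, by simp [Tf]⟩
      · exact ⟨1, by simp [Tf]⟩
    rcases w.isPrime.mem_or_mem hw with hD | hq'
    · obtain ⟨hXv, hYv⟩ := avatars_mem hθ hE hK htvD w hD
      obtain ⟨pe, hpe, hpv⟩ := exists_prime_of_mem hθ h3 hE hND0 hdn w hXv
      rcases dispatch_sound (cc := cc) hθ h3 hE hK hpr (hdnC pe hpe) w hpv hXv hYv with
        hq'' | ⟨C, hmem, hany, hC, hw', -⟩ | ⟨C, hmem, hany, hC, hw', -⟩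
      · exact hqw hq''
      · obtain ⟨bc, hbc, hbc1⟩ := List.mem_map.mp hmem
        obtain ⟨i, hi⟩ := List.mem_iff_get.mp hbc
        refine ⟨i.succ.succ, HeightOneSpectrum.ext ?_⟩
        simp only [Tf, Matrix.cons_val_succ]
        rw [hi, codePrime2, if_pos (by rw [hbc1]), show bc.1.2 = C by rw [hbc1],
          codePrimeR_asIdeal hθ h3 hR hprb hany hC, hw']
      · obtain ⟨bc, hbc, hbc1⟩ := List.mem_map.mp hmem
        obtain ⟨i, hi⟩ := List.mem_iff_get.mp hbc
        refine ⟨i.succ.succ, HeightOneSpectrum.ext ?_⟩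
        simp only [Tf, Matrix.cons_val_succ]
        rw [hi, codePrime2, if_neg (by rw [hbc1]; exact Bool.false_ne_true), show bc.1.2 = C by rw [hbc1],
          ClFieldCertE.codePrimeEta_asIdeal hθ h3 hE hpr hany hC, hw']
    · exact hqw hq'
  -- the family
  set fm := fam2 cc with hfm
  let W : Fin fm.length → 𝓞 K := fun j => eltOf F hθ hE (fm.get j).X (fm.get j).Y
  have hfam : ∀ j : Fin fm.length, famCheckE2 F cc (fm.get j) = true := fun j => hfamAll _ (List.get_mem _ j)
  have hW0 : ∀ j, W j ≠ 0 := fun j =>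
    eltOf_ne_zero hθ h3 hE hK (tv_of_famCheckE2 (hfam j)) (normFormZ_ne_of_famCheckE2 (hfam j))
  have hWval : ∀ j (v : HeightOneSpectrum (𝓞 K)),
      eltOf F hθ hE cc.XD cc.YD * ((F.fe.base.q : ℕ) : 𝓞 K) ∉ v.asIdeal →
        v.valuation K (algebraMap (𝓞 K) K (W j)) = 1 :=
    fun j v hv => valuation_eq_one_of_support _ _ (supp_of_famCheckE2 hθ h3 hE hK hpr hcodes htvD (hfam j)) v hv
  obtain ⟨ρ, hlo, hhi⟩ := F.fe.base.exists_rho_of_field hθ h3 hfd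
  -- independence modulo squares: the parity certificate (rows computed on `X = m₁ x`, `m₁` a square)
  have hind : ∀ S : Finset (Fin fm.length), IsSquare (∏ i ∈ S, algebraMap (𝓞 K) K (W i)) → S = ∅ := by
    intro S hS
    refine indep_of_parity_certificate (fun i => algebraMap (𝓞 K) K (W i)) (bit2 F cc) ?_ hcert S hS
    intro k S' hS'
    have hS'' : IsSquare (∏ i ∈ S', W i) := isSquare_prod_of_isSquare_prod_coe _ hS'
    obtain ⟨k, hk⟩ := k
    rcases k with _ | _ | _ | k
    · have h := even_card_of_isSquare_real ρ (fun i => algebraMap (𝓞 K) K (W i))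
        (fun i => rho_ne_zero_of_famCheckE2 hθ ρ hlo hhi h0 hE hK (hfam i)) hS'
      convert h using 2
      refine Finset.filter_congr (fun i _ => ?_)
      exact sign_iff_of_famCheckE2 hθ ρ hlo hhi h0 hE hK (hfam i)
    · exact even_card_of_isSquare_valuation (F.fe.base.W₁r hθ h3 hR hprb) W hW0 _
        (fun i => by
          show ((!decide ((2 : ℤ) ∣ famL₁2 (fm.get i))) = true ↔ _)
          rw [log_W₁_of_famCheckE2 hθ h3 hE hK hpr (hfam i)]; simp) hS'
    · exact even_card_of_isSquare_valuation (F.fe.base.W₂r hθ h3 hR hprb) W hW0 _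
        (fun i => by
          show ((!decide ((2 : ℤ) ∣ famL₂2 (fm.get i))) = true ↔ _)
          rw [log_W₂_of_famCheckE2 hθ h3 hE hK hpr (hfam i)]; simp) hS'
    · have hk' : k < F.fe.base.chars.length := by omega
      have hch : F.fe.base.chars.getD k ((3 : ℕ), (0 : ℤ), (0 : ℤ)) ∈ F.fe.base.chars := by
        rw [List.getD_eq_getElem?_getD, List.getElem?_eq_getElem hk', Option.getD_some]
        exact List.getElem_mem hk'
      obtain ⟨h2', ψ, hψ⟩ := F.fe.base.exists_psi_of_reg hθ h3 hR hprb hch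
      haveI : Fact (F.fe.base.chars.getD k (3, 0, 0)).1.Prime := ⟨F.fe.base.char_prime hprb hch⟩
      have hSX : IsSquare (∏ i ∈ S', lin hθ (fm.get i).X.1 (fm.get i).X.2.1 (fm.get i).X.2.2) := by
        have e1 : ∀ i ∈ S', lin hθ (fm.get i).X.1 (fm.get i).X.2.1 (fm.get i).X.2.2 = (F.m₁ : 𝓞 K) * W i :=
          fun i _ => (m₁_mul_eltOf hθ hE hK (tv_of_famCheckE2 (hfam i))).symm
        rw [Finset.prod_congr rfl e1, Finset.prod_mul_distrib, Finset.prod_const]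
        obtain ⟨z, hz⟩ := hS''
        refine ⟨(F.r₁ : 𝓞 K) ^ S'.card * z, ?_⟩
        rw [hz]
        simp only [ClFieldCertE2.m₁, Nat.cast_pow]
        ring
      have h := even_card_filter_eulerBit hθ (ℓ := (F.fe.base.chars.getD k (3, 0, 0)).1) (by omega) ψ hψ
        (fun i => (fm.get i).X) (fun i => not_dvd_evalInt_of_famCheckE2 (hfam i) hch) hSX
      convert h using 2
      exact Finset.filter_congr (fun i _ => Iff.rfl)
  -- spanning of the `T`-units modulo squares
  have hodd : Odd (finrank ℚ K) := by rw [h3]; decide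
  have hn : fm.length = NumberField.Units.rank K + 1 + (L + 2) := by
    rw [F.fe.base.units_rank_of_field hθ h3 hfd]
    simp only [hfm, fam2, List.length_append, List.length_map, hL, hhead]
    omega
  have hspan : ∀ u : K, u ≠ 0 →
      (∀ v : HeightOneSpectrum (𝓞 K),
        eltOf F hθ hE cc.XD cc.YD * ((F.fe.base.q : ℕ) : 𝓞 K) ∉ v.asIdeal → v.valuation K u = 1) →
      ∃ U : Finset (Fin fm.length), IsSquare (u * ∏ j ∈ U, algebraMap (𝓞 K) K (W j)) :=
    fun u hu huT => exists_isSquare_tunit_mul_prod hodd _ Tf hT hn (fun j => algebraMap (𝓞 K) K (W j))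
      (fun j => RingOfIntegers.coe_ne_zero_iff.mpr (hW0 j)) hWval hind u hu huT
  -- the sieve is sound at rational points
  haveI hEK : (((⟨0, cc.A, 0, cc.B, cc.C⟩ : WeierstrassCurve ℚ)).baseChange K).IsElliptic := ((⟨0, cc.A, 0, cc.B, cc.C⟩ : WeierstrassCurve ℚ)).isElliptic_baseChange K
  have hΔneg : ((⟨0, cc.A, 0, cc.B, cc.C⟩ : WeierstrassCurve ℚ)).Δ < 0 := by
    rw [Δ_shortModel_eq_sixteen_mul_disc]
    exact_mod_cast (show 16 * MonicCubic.disc cc.A cc.B cc.C < 0 by linarith [hdisc])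
  have hadm : ∀ c ∈ selmerGroup ((⟨0, cc.A, 0, cc.B, cc.C⟩ : WeierstrassCurve ℚ)) 2, ∀ a : Kˣ,
      kummerEquiv K 2 (((⟨0, cc.A, 0, cc.B, cc.C⟩ : WeierstrassCurve ℚ)).oneRootDescentH1 K
        (isTwoTorsionX_of_aeval (A := cc.A) (B := cc.B) (C := cc.C) ((⟨0, cc.A, 0, cc.B, cc.C⟩ : WeierstrassCurve ℚ)) rfl rfl rfl rfl rfl haev) c) =
        Additive.ofMul (QuotientGroup.mk a) →
      ∀ (T : Finset (Fin 0)) (U : Finset (Fin fm.length)),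
        IsSquare ((a : K) *
          (∏ i ∈ T, algebraMap (𝓞 K) K (((fun i : Fin 0 => i.elim0 : Fin 0 → (𝓞 K)ˣ) i : (𝓞 K)ˣ) : 𝓞 K)) *
            ∏ j ∈ U, algebraMap (𝓞 K) K (W j)) → adm2 F cc T U = true := by
    intro c hc a ha T U hsq
    have h1 : admStd (fun i : Fin 0 => i.elim0) (famNorm2 F cc) (fun i : Fin 0 => i.elim0) (famSign2 cc) T U =
        true :=
      admStd_sound_sel (A := cc.A) (B := cc.B) (C := cc.C) ((⟨0, cc.A, 0, cc.B, cc.C⟩ : WeierstrassCurve ℚ)) rfl rfl rfl rfl rfl hirrF' haev h3 ρ hΔneg (w := fun i : Fin 0 => algebraMap (𝓞 K) K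
          (((fun i : Fin 0 => i.elim0 : Fin 0 → (𝓞 K)ˣ) i : (𝓞 K)ˣ) : 𝓞 K))
        (g := fun j => algebraMap (𝓞 K) K (W j)) (fun i => i.elim0)
        (fun j => RingOfIntegers.coe_ne_zero_iff.mpr (hW0 j)) (fun i => i.elim0)
        (fun j => norm_eltOf hθ h3 hE hK (tv_of_famCheckE2 (hfam j)) (dvd_of_famCheckE2 (hfam j)))
        (fun i => i.elim0)
        (fun j => sign_iff_of_famCheckE2 hθ ρ hlo hhi h0 hE hK (hfam j)) hc a ha T U hsq
    have h2'' := valRow_sound_sel (A := cc.A) (B := cc.B) (C := cc.C) ((⟨0, cc.A, 0, cc.B, cc.C⟩ : WeierstrassCurve ℚ)) rfl rfl rfl rfl rfl haev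
      (F.fe.base.W₁r hθ h3 hR hprb) (by rw [hderiv]; exact hDW₁) hW0
      (r := fun j => bitRow2 F.fe.base (fm.get j) 1) (fun j => by
        show ((!decide ((2 : ℤ) ∣ famL₁2 (fm.get j))) = true ↔ _)
        rw [show algebraMap (𝓞 K) K (W j) = ((W j : 𝓞 K) : K) from rfl,
          log_W₁_of_famCheckE2 hθ h3 hE hK hpr (hfam j)]; simp) hc a ha T U hsq
    have h3'' := valRow_sound_sel (A := cc.A) (B := cc.B) (C := cc.C) ((⟨0, cc.A, 0, cc.B, cc.C⟩ : WeierstrassCurve ℚ)) rfl rfl rfl rfl rfl haev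
      (F.fe.base.W₂r hθ h3 hR hprb) (by rw [hderiv]; exact hDW₂) hW0
      (r := fun j => bitRow2 F.fe.base (fm.get j) 2) (fun j => by
        show ((!decide ((2 : ℤ) ∣ famL₂2 (fm.get j))) = true ↔ _)
        rw [show algebraMap (𝓞 K) K (W j) = ((W j : 𝓞 K) : K) from rfl,
          log_W₂_of_famCheckE2 hθ h3 hE hK hpr (hfam j)]; simp) hc a ha T U hsq
    simp only [adm2, Bool.and_eq_true]
    exact ⟨⟨admStdQ_of_admStd hQ h1, h2''⟩, h3''⟩
  -- the killed classes: rescale `∏_{j ∈ U} X_j(θ) = m₁^{#U} · ∏_{j ∈ U} W_j`, `m₁ = r₁²`, then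
  -- `admKillsV_sound_sel` over the `X`-coordinates of the family (no separate units), root `e₀ = X_t(θ)/m₁`
  have he₀ : (F.r₁ : K) ^ 2 * algebraMap (𝓞 K) K (eltOf F hθ hE cc.Xt cc.Yt) = evZ θ (cc.Xt.1, cc.Xt.2.1, cc.Xt.2.2) := by
    rw [← algebraMap_lin_evZ hθ (cc.Xt.1, cc.Xt.2.1, cc.Xt.2.2), ← hXe, ClFieldCertE2.m₁, Nat.cast_pow]
  have hLV := killListCheckV_of_liteE2V hlite (killValidE2_of_residue hk)
  have hadmK : ∀ c ∈ selmerGroup ((⟨0, cc.A, 0, cc.B, cc.C⟩ : WeierstrassCurve ℚ)) 2, ∀ a : Kˣ,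
      kummerEquiv K 2 (((⟨0, cc.A, 0, cc.B, cc.C⟩ : WeierstrassCurve ℚ)).oneRootDescentH1 K
        (isTwoTorsionX_of_aeval (A := cc.A) (B := cc.B) (C := cc.C) ((⟨0, cc.A, 0, cc.B, cc.C⟩ : WeierstrassCurve ℚ)) rfl rfl rfl rfl rfl haev) c) =
        Additive.ofMul (QuotientGroup.mk a) →
      ∀ (T : Finset (Fin 0)) (U : Finset (Fin fm.length)),
        IsSquare ((a : K) *
          (∏ i ∈ T, algebraMap (𝓞 K) K (((fun i : Fin 0 => i.elim0 : Fin 0 → (𝓞 K)ˣ) i : (𝓞 K)ˣ) : 𝓞 K)) *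
            ∏ j ∈ U, algebraMap (𝓞 K) K (W j)) → admE2K F cc ks T U = true := by
    intro c hc a ha T U hsq
    have hsq' : IsSquare ((a : K) *
        (∏ i ∈ T, algebraMap (𝓞 K) K (((fun i : Fin 0 => i.elim0 : Fin 0 → (𝓞 K)ˣ) i : (𝓞 K)ˣ) : 𝓞 K)) *
          ∏ j ∈ U, algebraMap (𝓞 K) K (lin hθ (fm.get j).X.1 (fm.get j).X.2.1 (fm.get j).X.2.2)) := by
      have e1 : ∀ j ∈ U, algebraMap (𝓞 K) K (lin hθ (fm.get j).X.1 (fm.get j).X.2.1 (fm.get j).X.2.2) =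
          (F.m₁ : K) * algebraMap (𝓞 K) K (W j) :=
        fun j _ => (m₁_mul_eltOf_coe hθ hE hK (tv_of_famCheckE2 (hfam j))).symm
      rw [Finset.prod_congr rfl e1, Finset.prod_mul_distrib, Finset.prod_const]
      obtain ⟨w, hw⟩ := hsq
      have hm : (F.m₁ : K) ^ U.card = ((F.r₁ : K) ^ U.card) ^ 2 := by
        rw [ClFieldCertE2.m₁, Nat.cast_pow, ← pow_mul, ← pow_mul, Nat.mul_comm]
      refine ⟨(F.r₁ : K) ^ U.card * w, ?_⟩
      calc (a : K) *
            (∏ i ∈ T, algebraMap (𝓞 K) K (((fun i : Fin 0 => i.elim0 : Fin 0 → (𝓞 K)ˣ) i : (𝓞 K)ˣ) : 𝓞 K)) *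
              ((F.m₁ : K) ^ U.card * ∏ j ∈ U, algebraMap (𝓞 K) K (W j))
          = (F.m₁ : K) ^ U.card * ((a : K) *
              (∏ i ∈ T, algebraMap (𝓞 K) K
                (((fun i : Fin 0 => i.elim0 : Fin 0 → (𝓞 K)ˣ) i : (𝓞 K)ˣ) : 𝓞 K)) *
                ∏ j ∈ U, algebraMap (𝓞 K) K (W j)) := by ring
        _ = ((F.r₁ : K) ^ U.card) ^ 2 * (w * w) := by rw [hm, hw]
        _ = (F.r₁ : K) ^ U.card * w * ((F.r₁ : K) ^ U.card * w) := by ring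
    exact admKillsV_sound_sel (A := cc.A) (B := cc.B) (C := cc.C) hirr hθ h3
      ((⟨0, cc.A, 0, cc.B, cc.C⟩ : WeierstrassCurve ℚ)) rfl rfl rfl rfl rfl (eltOf F hθ hE cc.Xt cc.Yt) haev
      cc.Xt.1 F.r₁ he₀
      (u := fun i : Fin 0 => (((fun i : Fin 0 => i.elim0 : Fin 0 → (𝓞 K)ˣ) i : (𝓞 K)ˣ) : 𝓞 K))
      (fun j => lin hθ (fm.get j).X.1 (fm.get j).X.2.1 (fm.get j).X.2.2)
      (cu := unitCoordsE2) (cg := famCoordsE2 cc) (fun i => i.elim0) (fun j => rfl) hLV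
      (killResidue_entries hk) (hadm c hc a ha T U hsq) hc a ha hsq'
  -- the trivial class passes the sieve
  have hadm0 : adm2 F cc ∅ ∅ = true := by
    simp only [adm2, Bool.and_eq_true, decide_eq_true_eq, Finset.filter_empty, Finset.card_empty]
    exact ⟨⟨admStdQ_empty _ hQ _ _ _ _, by decide⟩, by decide⟩
  -- the live list: listed AND passing the sieve; by `hSall` its membership test IS the sieve
  have hSall' : ∀ U : Finset (Fin fm.length), admE2K F cc ks ∅ U = true → U ∈ liveE2KS F cc ks sv :=
    fun U hU => List.mem_filter.mpr ⟨hSall U hU, hU⟩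
  have hext : (fun U : Finset (Fin fm.length) => decide (U ∈ liveE2KS F cc ks sv)) =
      (fun U => admE2K F cc ks ∅ U) := by
    funext U
    by_cases h : admE2K F cc ks ∅ U = true
    · rw [h]
      exact decide_eq_true (hSall' U h)
    · rw [Bool.not_eq_true] at h
      rw [h]
      exact decide_eq_false fun hm => Bool.eq_false_iff.mp h (List.mem_filter.mp hm).2
  rw [hext] at hns
  have hsel := natCard_selmerGroup_lt_of_coverSet_cl_noSub (A := cc.A) (B := cc.B) (C := cc.C)
    (⟨0, cc.A, 0, cc.B, cc.C⟩ : WeierstrassCurve ℚ) rfl rfl rfl rfl rfl hirrF' haev h3 hM0 hgen hDM hW0 hspan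
    (Wu := fun i : Fin 0 => i.elim0) (adm := admE2K F cc ks)
    (admKills_empty hadm0 (noTrivial_of_liteE2V hlite)) hadmK hind hSall' (s' := r) hns
  exact sha_door_of_natCard_selmerGroup_two_lt ((⟨0, cc.A, 0, cc.B, cc.C⟩ : WeierstrassCurve ℚ)) hsel hlow

end Row

end Summit.BirchSwinnertonDyer.BirchSwinnertonDyer.Theorems.ShaPrimaryTransferSelmerCubicCover

end
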